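import Literature.AnabelianGeometry.AbsoluteAnabelian.AbsTopII.BelyiCuspidalizationSchemaScope
import Literature.AnabelianGeometry.AbsoluteAnabelian.MLFAbsoluteGaloisGroupInfinite
import HarnessLib

/-!
# [AbsTopII] Cor 3.7 / Cor 3.8 as typed over a class `𝒟` (`BelyiModel 𝒟`) are SCHEMATA: their
# universal closures are refutable, and `Cor_3_7` is inhabited from centre-freeness alone
# (FACT-LIST F-0232 / F-0271)

S. Mochizuki, *Topics in Absolute Anabelian Geometry II: Decomposition Groups and Endomorphisms*
[AbsTopII] (bib key `MochizukiAbsTopII2013`; manuscript pagination, lit key `paper:url-585b8d0ad0d9`):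
Corollary 3.7 pp. 72–73, Corollary 3.8 p. 74 (with [AbsTopI] Def 4.6: "`𝒟` chain-full, rel-isom-DGC").

PROOF-ONLY negative-knowledge / scope companion (no definition, no instance, no structure) of
`AbsTopII/CuspidalizationComparison.lean` (abc-iut-L4-t13, Cor 3.7 / 3.8 in printed generality over an
[AbsTopI] Def-4.6 class `𝒟 : ConstructionDataClass` and a model `M : BelyiModel 𝒟`), cell abc-iut, seat
abc-iut-f-064 (FACT-LIST rows **F-0232** `BelyiModel.Cor_3_7`, **F-0271** `BelyiModel.Cor_3_8`; class
`preparatory`, kernel_closedness `parametrised`).  Sequel of `BelyiCuspidalizationSchemaScope.lean`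
(the instantiated typing over `BelyiCurveModel`, rows F-0267 / F-0268), whose generic lemmas
`BelyiCuspidalization.not_isoOver_of_central_mem_ker`,
`Cuspidalization.exists_belyiCuspidalization_of_center_eq_bot` and `Cuspidalization.isSlimGroup_gal` are
reused.

As there, the interface data are free (the class `𝒟`: its construction-data fields `k_b` — REAL fields —,
the relative anabelian datum over `Gal(k̄_b/k_b)` with "the natural map `f ↦ [π₁(f)]`" as a FIELD, the
membership predicate, the chain terms; the model `M`: cusps, "strictly Belyi type", NF-opens and their
cuspidalizations), while the hypotheses `IsChainFull`, `RelIsomDGC`, `IsCor37Member` are NOT: a junk class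
over `k := ℚ_2` with ONE relative anabelian datum whose `Hom`-sets ARE the outer isomorphisms (so the
rel-isom-DGC holds by construction), no chain terms (chain-full), members `Π := G_{ℚ_2} × G_{ℚ_2} ↠ G_{ℚ_2}`
(second projection; `Δ = G_{ℚ_2} × 1` is slim and nontrivial — [Tpcs] Lem 4.14 kernel-proved,
`Padic.infinite_absoluteGaloisGroup`) satisfies every hypothesis UNCONDITIONALLY
(`BelyiModel.isCor37Member_of_isGeneralizedSubpadicFor`).  This file records:

* `hasTerminalChainOfType_ex_3_6_ii_zero` — the CHAIN CLAUSE of the typed `Cor_3_7` ("a `Π`-chain with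
  associated type-chain `⋏, ⋎, •, …, •, ⋏, •, …, •, ⋎` that admits a terminal isomorphism with the trivial
  `Π`-chain", abc-iut-L4-t4's `PiChain`) is met, for chain parameters `(0,0,0)` and `Π_V := Π`, by the
  identity chain `Π ⇝ Π ⇝ Π ⇝ Π ⇝ Π` of type `⋏, ⋎, ⋏, ⋎` (identity open immersions; cf. the landed sanity
  lemma `hasTerminalChainOfType_quot_top`): the clause constrains the type-chain, not the groups;
* INSTANCE FORMS that hold: `BelyiModel.cor_3_7_of_center_eq_bot`, `cor_3_7_of_isSlimGroup_cuspOf_arith`,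
  `cor_3_7_of_isSlimGroup_cuspOf_geom` — `Cor_3_7 M` follows from the slimness of the `Δ_{U_X}` of the
  model alone (so the typed statement carries the SHAPE of the output, the centre-freeness behind (b) and
  the type-chain of (a), not the group-theoreticity of (a) — RQ7 A21g4-F1 extended to the `𝒟`-typing);
  `cor_3_7_of_isEmpty_nfOpen`, `cor_3_8_of_isEmpty_nfOpen` (vacuous);
* `BelyiModel.exists_not_cor_3_7_and_not_cor_3_8` / `not_forall_cor_3_7` / `not_forall_cor_3_8` —
  **universal closures REFUTED** (universe `0`) on the junk class above with the model: two members
  `tt`, `ff`, ONE NF-open on `tt` with cuspidalization `(G × G) × ℤ/2 ↠ G × G` (central kernel), NONE on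
  `ff`; `Cor_3_7` fails by `not_isoOver_of_central_mem_ker`, `Cor_3_8` at `φ = id` for want of a `U_{ff}`.

READING (honest framing): statements about OUR typed interface — `BelyiModel.Cor_3_7` / `Cor_3_8` are
HYPOTHESES ON `(𝒟, M)`, bindable per instance (the étale-`π₁` class of [AbsTopI] Ex 4.8 (i), FOUNDATIONS
row 12), never as universally quantified binders.  NOTHING in print is contradicted: Cor 3.7 / 3.8 are
theorems about hyperbolic orbicurves of strictly Belyi type over a chain-full class with rel-isom-DGC,
objects the tree does not construct.  Refuted-as-schema ≠ refuted-in-print; no side taken on [IUTchIII]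
Cor 3.12; typed ≠ proved.
-/

open CategoryTheory Topology
open scoped Pointwise

universe u

namespace Literature.AnabelianGeometry.AbsoluteAnabelian.AbsTopII

open Literature.AlgebraicGeometry.Frobenioids (IsSlimGroup)
open FundamentalExtension
open AbsTopI (ConstructionDataClass)
open AbsTopIII (IsGeneralizedSubpadicFor IsSubpadicFor cyclotomicChar)

/-! ## The chain clause of the typed Cor 3.7 (a) for chain parameters `(0,0,0)` -/

section Chains

variable {E : FundamentalExtension.{u}} {C : CuspidalData E} {hP : IsSlimGroup E.arith}
  {hΔ : IsSlimGroup E.geom} {hne : E.geom ≠ ⊥}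

/-- The identity of `Π` as an elementary operation of type `⋏` from `Π₀ = Π` to itself (an open immersion
compatible with the rigidifying homomorphisms, [AbsTopI] Def 4.2 (iii)(a)) — companion of the landed
`isElemOp_finEtQuot_self` (type `⋎`). [cite: MochizukiAbsTopII2013, Cor 3.7 (a) p.73] -/
theorem isElemOp_finEtCov_self :
    ChainGroup.IsElemOp C .finEtCov (ChainGroup.self hP hΔ hne) (ChainGroup.self hP hΔ hne) := by
  refine ⟨ContinuousMonoidHom.id _, fun _ _ h => h, ?_, ⊤, isOpen_univ, le_rfl, le_rfl, fun _ => rfl⟩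
  rw [show Set.range (ContinuousMonoidHom.id ((ChainGroup.self hP hΔ hne : E.ChainGroup).grp)) =
      Set.univ from Set.range_eq_univ.mpr fun x => ⟨x, rfl⟩]
  exact isOpen_univ

variable (C hP hΔ hne) in
/-- **The chain clause of Cor 3.7 (a) for `(l, n, m) = (0, 0, 0)` and `Π_V := Π` holds on EVERY
extension**: the chain `Π ⇝ Π ⇝ Π ⇝ Π ⇝ Π` of identities has type-chain `⋏, ⋎, ⋏, ⋎`
(= `Ex_3_6_ii_typeChain 0 0 0`), admits a terminal isomorphism with the trivial chain (the identity), and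
its second-to-last group `Π₃ = Π` is `⊤ ⊆ Π` — so `HasTerminalChainOfType … B.typeChain B.PiV` constrains
only the recorded type-chain and `Π_V`, not the group-theoretic construction of (a).
[cite: MochizukiAbsTopII2013, Cor 3.7 (a) p.73] -/
theorem hasTerminalChainOfType_ex_3_6_ii_zero :
    HasTerminalChainOfType C hP hΔ hne (Ex_3_6_ii_typeChain 0 0 0) ⊤ := by
  let c : E.PiChain C hP hΔ hne :=
    { len := 4
      term := fun _ => ChainGroup.self hP hΔ hne
      term_zero := rfl
      types := ![.finEtCov, .finEtQuot, .finEtCov, .finEtQuot]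
      isElemOp := fun j => by
        fin_cases j
        · exact isElemOp_finEtCov_self
        · exact isElemOp_finEtQuot_self
        · exact isElemOp_finEtCov_self
        · exact isElemOp_finEtQuot_self }
  refine ⟨c, rfl, ⟨ContinuousMulEquiv.refl _, 1, fun x => ?_⟩, 3, rfl, topContinuousMulEquiv E,
    1, fun x => ?_⟩
  · simp only [map_one, MulAut.one_apply]
    rfl
  · simp only [map_one, MulAut.one_apply]
    rfl

end Chains

variable {𝒟 : ConstructionDataClass.{u}}

namespace BelyiModel

variable (M : BelyiModel 𝒟)

/-! ## F-0232: instance forms of `BelyiModel.Cor_3_7` that DO hold -/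

/-- **`Cor_3_7 M` from centre-freeness alone**: if every `Π_{U_X}` of the model (for members satisfying
the Cor-3.7 hypotheses) has trivial centre, then `BelyiModel.Cor_3_7 M` holds — with the model's own
`π₁(U_X) ↠ Π`, `Π_V := Π`, and the identity chain of type `⋏, ⋎, ⋏, ⋎` for clause (a); the hypotheses
"`𝒟` chain-full, rel-isom-DGC" are not used. [cite: MochizukiAbsTopII2013, Cor 3.7 pp.72-73] -/
theorem cor_3_7_of_center_eq_bot
    (hZ : ∀ (b : 𝒟.Base) (X : (𝒟.datum b).Obj), M.IsCor37Member b X → ∀ U : M.NFOpen b X,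
      Subgroup.center (M.cuspOf U).ext.arith = ⊥) :
    M.Cor_3_7 := by
  intro _ _ b X h U
  obtain ⟨B, h₁, h₂, hV, hτ⟩ :=
    (M.cuspOf U).exists_belyiCuspidalization_of_center_eq_bot (M.cuspsOf U) (hZ b X h U)
  refine ⟨B, h₁, h₂, ?_⟩
  rw [hV, hτ]
  exact hasTerminalChainOfType_ex_3_6_ii_zero _ _ _ _

/-- `Cor_3_7 M` from the slimness of the `Π_{U_X}` of the model (a slim group is centre-free).
[cite: MochizukiAbsTopII2013, Cor 3.7 pp.72-73] -/
theorem cor_3_7_of_isSlimGroup_cuspOf_arith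
    (hP : ∀ (b : 𝒟.Base) (X : (𝒟.datum b).Obj), M.IsCor37Member b X → ∀ U : M.NFOpen b X,
      IsSlimGroup (M.cuspOf U).ext.arith) :
    M.Cor_3_7 := by
  refine M.cor_3_7_of_center_eq_bot fun b X h U => ?_
  rw [eq_bot_iff]
  intro g hg
  rw [← (hP b X h U).centralizer_eq_bot ⊤ isOpen_univ, Subgroup.mem_centralizer_iff]
  exact fun x _ => (Subgroup.mem_center_iff.mp hg) x

/-- **Cor 3.7 (printed generality) as typed, CONDITIONAL on a classical input only**: if the geometric
fundamental groups `Δ_{U_X}` of the model's NF-opens are slim, then `BelyiModel.Cor_3_7 M` holds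
(`Π_{U_X}` slim by [AbsAnab] Lem 1.3.1 = `arith_slim_of_geom_slim_of_gal_slim`, "`G` slim" from
`IsCor37Member` carried over by `Cuspidalization.isSlimGroup_gal`).
[cite: MochizukiAbsTopII2013, Cor 3.7 pp.72-73] -/
theorem cor_3_7_of_isSlimGroup_cuspOf_geom
    (hΔ : ∀ (b : 𝒟.Base) (X : (𝒟.datum b).Obj), M.IsCor37Member b X → ∀ U : M.NFOpen b X,
      IsSlimGroup (M.cuspOf U).ext.geom) :
    M.Cor_3_7 :=
  M.cor_3_7_of_isSlimGroup_cuspOf_arith fun b X h U =>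
    (M.cuspOf U).ext.arith_slim_of_geom_slim_of_gal_slim (hΔ b X h U)
      ((M.cuspOf U).isSlimGroup_gal h.slim)

/-- Instance form that holds VACUOUSLY: a model none of whose members has an NF-rational open satisfies
`Cor_3_7`. [cite: MochizukiAbsTopII2013, Cor 3.7 pp.72-73] -/
theorem cor_3_7_of_isEmpty_nfOpen (h : ∀ (b : 𝒟.Base) (X : (𝒟.datum b).Obj), IsEmpty (M.NFOpen b X)) :
    M.Cor_3_7 :=
  fun _ _ b X _ U => (h b X).elim U

/-! ## F-0271: instance form of `BelyiModel.Cor_3_8` that holds -/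

/-- Instance form that holds VACUOUSLY: a model none of whose members has an NF-rational open satisfies
`Cor_3_8`. [cite: MochizukiAbsTopII2013, Cor 3.8 p.74] -/
theorem cor_3_8_of_isEmpty_nfOpen (h : ∀ (b : 𝒟.Base) (X : (𝒟.datum b).Obj), IsEmpty (M.NFOpen b X)) :
    M.Cor_3_8 :=
  fun _ _ b₁ _ X₁ _ _ _ _ _ _ U₁ => (h b₁ X₁).elim U₁

end BelyiModel

/-! ## F-0232 / F-0271: the universal closures are REFUTED -/

/-- **The junk class and model over `ℚ_2`** (universe `0`).  Class `𝒟`: one construction-data field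
`ℚ_2`; ONE relative anabelian datum over `G := Gal(ℚ̄_2/ℚ_2)` with objects `tt`, `ff`, both with group
`Π := G × G ↠ G` (second projection, `Δ = G × 1`), `Hom(X, Y) :=` the outer ISOMORPHISMS `Π ⥲ Π` over `G`
with `f ↦ [π₁(f)]` the inclusion (so the rel-isom-DGC holds BY CONSTRUCTION), all objects hyperbolic
curves and members, `Σ := Primes`, no chain terms (chain-full vacuously).  Model `M`: no cusps, every
member of strictly Belyi type by fiat, `tt` with ONE NF-open whose cuspidalization is
`(G × G) × ℤ/2 ↠ G × G` (first projection), `ff` with NONE.  Both members satisfy `IsCor37Member`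
UNCONDITIONALLY (`ℚ_2` generalized sub-`2`-adic; `G` slim by [Tpcs] Lem 4.14, kernel-proved; `Δ ≅ G` slim
and nontrivial by `Padic.infinite_absoluteGaloisGroup`; `χ_2` open by [AbsTopI] Ex 4.8 (i), kernel-proved),
yet `Cor_3_7` fails (`ℤ/2` central in `Π_U`) and `Cor_3_8` fails (no `U_{ff}` for `φ = id`).
[cite: MochizukiAbsTopII2013, Cor 3.7 pp.72-73] -/
theorem BelyiModel.exists_not_cor_3_7_and_not_cor_3_8 :
    ∃ (𝒟 : ConstructionDataClass.{0}) (M : BelyiModel 𝒟), ¬ M.Cor_3_7 ∧ ¬ M.Cor_3_8 := by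
  let Γ : ProfiniteGrp.{0} := absoluteGaloisGrp ℚ_[2]
  let A : ProfiniteGrp.{0} := ProfiniteGrp.ofFiniteGrp (FiniteGrp.of (Multiplicative (ZMod 2)))
  -- the member: `Π := G × G ↠ G` (second projection)
  let P : AugmentedProfiniteGrp Γ :=
    { arith := ProfiniteGrp.of (Γ × Γ), aug := ContinuousMonoidHom.snd Γ Γ
      aug_surjective := fun g => ⟨(1, g), rfl⟩ }
  let D : RelativeAnabelianDatum Γ :=
    { Obj := Bool
      Hom := fun _ _ => {q : AugmentedProfiniteGrp.OuterHom P P // q.IsIso}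
      IsIso := fun _ => True
      IsHyperbolicCurve := fun _ => True
      primes := Set.univ
      grp := fun _ => P
      outerHom := fun q => q.1 }
  let 𝒟 : ConstructionDataClass.{0} :=
    { Base := PUnit.{1}
      fld := fun _ => ℚ_[2]
      instField := fun _ => inferInstance
      instCharZero := fun _ => inferInstance
      datum := fun _ => D
      Mem := fun _ _ => True
      IsHyperbolicOrbicurve := fun _ _ => True
      isHyperbolicOrbicurve_of_isHyperbolicCurve := fun _ _ _ => trivial
      chainTerms := fun _ _ => ∅ }
  let E₀ : FundamentalExtension.{0} := P.toExtension
  let C₀ : CuspidalData E₀ :=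
    { Cusp := PEmpty.{1}
      Dcusp := fun x => x.elim
      Icusp := fun x => x.elim
      Icusp_eq := fun x => x.elim
      isClosed_Dcusp := fun x => x.elim
      eq_of_conj := fun x => x.elim }
  -- the junk cuspidalization `Π_U := (G × G) × ℤ/2 ↠ G × G`
  let E₁ : FundamentalExtension.{0} :=
    { arith := ProfiniteGrp.of ((Γ × Γ) × A), gal := Γ
      aug := (ContinuousMonoidHom.snd Γ Γ).comp (ContinuousMonoidHom.fst (Γ × Γ) A)
      aug_surjective := fun g => ⟨((1, g), 1), rfl⟩ }
  let f : E₁ ⟶ E₀ := ⟨ContinuousMonoidHom.fst (Γ × Γ) A, ContinuousMonoidHom.id Γ, fun _ => rfl⟩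
  let c : Cuspidalization E₀ := ⟨E₁, f, fun g => ⟨(g, 1), rfl⟩, Function.bijective_id⟩
  let C₁ : CuspidalData E₁ :=
    { Cusp := PEmpty.{1}
      Dcusp := fun x => x.elim
      Icusp := fun x => x.elim
      Icusp_eq := fun x => x.elim
      isClosed_Dcusp := fun x => x.elim
      eq_of_conj := fun x => x.elim }
  let M : BelyiModel 𝒟 :=
    { cusps := fun _ _ => C₀
      IsStrictlyBelyiType := fun _ _ => True
      NFOpen := fun _ X => cond X PUnit.{1} PEmpty.{1}
      cuspOf := fun _ => c
      cuspsOf := fun _ => C₁ }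
  have hfull : 𝒟.IsChainFull := fun _ _ _ _ ht => ((Set.mem_empty_iff_false _).mp ht).elim
  have hGC : 𝒟.RelIsomDGC := fun _ _ _ _ _ =>
    ⟨fun q _ => q.2, fun q _ q' _ h => Subtype.ext h, fun q hq => ⟨⟨q, hq⟩, trivial, rfl⟩⟩
  have hk : IsGeneralizedSubpadicFor ℚ_[2] 2 := (IsSubpadicFor.padic 2).isGeneralizedSubpadicFor
  have hΓ : IsSlimGroup Γ :=
    isSlimGroup_of_iso_absoluteGaloisGrp_of_isGeneralizedSubpadicFor_holds hk (Iso.refl _)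
  -- `Δ = G × 1 ≅ G` is slim …
  let e : Γ ≃ₜ* ↥E₀.geom :=
    { toFun := fun g => ⟨(g, 1), rfl⟩
      invFun := fun x => x.1.1
      left_inv := fun _ => rfl
      right_inv := fun x => by
        obtain ⟨⟨g, h⟩, hx⟩ := x
        have hh : h = 1 := hx
        subst hh
        rfl
      map_mul' := fun g h => Subtype.ext (Prod.ext rfl (one_mul (1 : Γ)).symm)
      continuous_toFun := Continuous.subtype_mk (continuous_id.prodMk continuous_const) _
      continuous_invFun := continuous_fst.comp continuous_subtype_val }
  have hΔ : IsSlimGroup ↥E₀.geom := isSlimGroup_of_continuousMulEquiv e hΓ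
  -- … and nontrivial
  haveI : Infinite (Field.absoluteGaloisGroup ℚ_[2]) := Padic.infinite_absoluteGaloisGroup 2
  obtain ⟨σ, hσ⟩ := exists_ne (1 : Field.absoluteGaloisGroup ℚ_[2])
  have hne : E₀.geom ≠ ⊥ := by
    intro h
    have hmem : ((σ, 1) : Γ × Γ) ∈ E₀.geom := rfl
    rw [h] at hmem
    exact hσ (Prod.mk_eq_one.mp (Subgroup.mem_bot.mp hmem)).1
  have hX : ∀ X : Bool, M.IsCor37Member PUnit.unit X := fun X =>
    M.isCor37Member_of_isGeneralizedSubpadicFor trivial rfl trivial hk hΔ hne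
  -- the nontrivial central element `(1, -1)` of `Π_U`, in the kernel of `Π_U ↠ Π`
  let a : Multiplicative (ZMod 2) := Multiplicative.ofAdd 1
  have ha : a ≠ 1 := Multiplicative.ofAdd.injective.ne (by decide : (1 : ZMod 2) ≠ 0)
  have hcomm : ∀ z : (Γ × Γ) × A, ((1, a) : (Γ × Γ) × A) * z = z * (1, a) := by
    rintro ⟨u, b⟩
    refine Prod.ext ?_ (@mul_comm (Multiplicative (ZMod 2)) _ a b)
    change 1 * u = u * 1
    rw [one_mul, mul_one]
  refine ⟨𝒟, M, fun h37 => ?_, fun h38 => ?_⟩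
  · obtain ⟨B, hiso, -⟩ := h37 hfull hGC PUnit.unit true (hX true) PUnit.unit
    exact B.not_isoOver_of_central_mem_ker c ((1, a) : (Γ × Γ) × A)
      (fun h => ha (Prod.mk_eq_one.mp h).2) rfl hcomm hiso
  · have hcyc : IsOpen (Set.range (cyclotomicChar ℚ_[2] 2)) := hk.isOpen_range_cyclotomicChar
    obtain ⟨U₂, -⟩ := h38 hfull hGC PUnit.unit PUnit.unit true false (hX true) (hX false)
      ⟨2, inferInstance, hcyc, hcyc⟩ (ContinuousMulEquiv.refl _) (by
        ext x
        simp only [Subgroup.mem_map]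
        constructor
        · rintro ⟨y, hy, rfl⟩
          exact hy
        · exact fun hx => ⟨x, hx, rfl⟩) PUnit.unit
    exact PEmpty.elim U₂

/-- **FACT-LIST F-0232, universal closure REFUTED** (universe `0`): it is not the case that
`BelyiModel.Cor_3_7 M` holds for every class `𝒟` and model `M` — a HYPOTHESIS ON `(𝒟, M)`, bindable per
instance, not a closed fact.  Cor 3.7 itself is not touched. [cite: MochizukiAbsTopII2013, Cor 3.7 pp.72-73] -/
theorem BelyiModel.not_forall_cor_3_7 :
    ¬ ∀ (𝒟 : ConstructionDataClass.{0}) (M : BelyiModel 𝒟), M.Cor_3_7 := by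
  intro H
  obtain ⟨𝒟, M, h37, -⟩ := BelyiModel.exists_not_cor_3_7_and_not_cor_3_8
  exact h37 (H 𝒟 M)

/-- **FACT-LIST F-0271, universal closure REFUTED** (universe `0`): it is not the case that
`BelyiModel.Cor_3_8 M` holds for every class `𝒟` and model `M` — a HYPOTHESIS ON `(𝒟, M)`, not a closed
fact.  Cor 3.8 itself is not touched. [cite: MochizukiAbsTopII2013, Cor 3.8 p.74] -/
theorem BelyiModel.not_forall_cor_3_8 :
    ¬ ∀ (𝒟 : ConstructionDataClass.{0}) (M : BelyiModel 𝒟), M.Cor_3_8 := by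
  intro H
  obtain ⟨𝒟, M, -, h38⟩ := BelyiModel.exists_not_cor_3_7_and_not_cor_3_8
  exact h38 (H 𝒟 M)

end Literature.AnabelianGeometry.AbsoluteAnabelian.AbsTopII
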